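import Summits.RiemannHypothesis.RiemannHypothesis.Theorems.WeilTwoPrimeDeflM80PBase
import Literature.NumberTheory.LFunctions.WeilBlockRows
import Literature.NumberTheory.LFunctions.WeilBlockRowsDCFast
import HarnessLib

/-!
# Even-sector deflated two-prime certificate M80P: rows 80–83 of the even check `D C = I`

`WeilCert.checkDCRow 0` for certificate M80P, row by row via the linear-traversal check `WeilCert.checkDCRowF` (`decide +kernel`) and `WeilCert.checkDCRow_of_F`. Pure proof file.
-/

set_option linter.dupNamespace false

noncomputable section

namespace Summit.RiemannHypothesis.RiemannHypothesis.Theorems.EvenWinsBeyondArch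

open Literature.NumberTheory.LFunctions

set_option maxHeartbeats 0 in
/-- Fast kernel check of row 80 of the even `D C = I` (certificate M80P; linear traversals). [folklore] -/
theorem checkDCRowF0_80_weilCertDeflM80P : weilCertDeflM80PBase.checkDCRowF 0 80 = true := by
  decide +kernel

/-- Row 80 of the even `D C = I` (certificate M80P), from the fast check. [folklore] -/
theorem checkDCRow0_80_weilCertDeflM80P : weilCertDeflM80PBase.checkDCRow 0 80 = true :=
  WeilCert.checkDCRow_of_F checkDCRowF0_80_weilCertDeflM80P

set_option maxHeartbeats 0 in
/-- Fast kernel check of row 81 of the even `D C = I` (certificate M80P; linear traversals). [folklore] -/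
theorem checkDCRowF0_81_weilCertDeflM80P : weilCertDeflM80PBase.checkDCRowF 0 81 = true := by
  decide +kernel

/-- Row 81 of the even `D C = I` (certificate M80P), from the fast check. [folklore] -/
theorem checkDCRow0_81_weilCertDeflM80P : weilCertDeflM80PBase.checkDCRow 0 81 = true :=
  WeilCert.checkDCRow_of_F checkDCRowF0_81_weilCertDeflM80P

set_option maxHeartbeats 0 in
/-- Fast kernel check of row 82 of the even `D C = I` (certificate M80P; linear traversals). [folklore] -/
theorem checkDCRowF0_82_weilCertDeflM80P : weilCertDeflM80PBase.checkDCRowF 0 82 = true := by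
  decide +kernel

/-- Row 82 of the even `D C = I` (certificate M80P), from the fast check. [folklore] -/
theorem checkDCRow0_82_weilCertDeflM80P : weilCertDeflM80PBase.checkDCRow 0 82 = true :=
  WeilCert.checkDCRow_of_F checkDCRowF0_82_weilCertDeflM80P

set_option maxHeartbeats 0 in
/-- Fast kernel check of row 83 of the even `D C = I` (certificate M80P; linear traversals). [folklore] -/
theorem checkDCRowF0_83_weilCertDeflM80P : weilCertDeflM80PBase.checkDCRowF 0 83 = true := by
  decide +kernel

/-- Row 83 of the even `D C = I` (certificate M80P), from the fast check. [folklore] -/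
theorem checkDCRow0_83_weilCertDeflM80P : weilCertDeflM80PBase.checkDCRow 0 83 = true :=
  WeilCert.checkDCRow_of_F checkDCRowF0_83_weilCertDeflM80P


end Summit.RiemannHypothesis.RiemannHypothesis.Theorems.EvenWinsBeyondArch
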